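import Summits.Ventures.Crystal3D.Bulk.HullRotSys
import HarnessLib

/-!
# The hull rotation system, part 2: the face permutation `φ_H = σ_H ∘ α`, its orbits are the
# fan triangles, and the counts `#darts = 3 · #triangles`, `#triangles = 2N − 4`
# (brick (G2) of `phase2/LEAN-FACES-DESIGN.md` §5.3, continued)

HONEST FRAMING. Part of the venture `Summits/Ventures/Crystal3D` (cell `pub-crystal3d`, phase 2;
seat p3), generic and configuration-free (`X` any finite set of unit vectors of `ℝ³` with
`0 ∈ interior (conv X)`); nothing here mentions GAP(1.26). Continuing `Bulk/HullRotSys.lean`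
(darts `hullDarts X`, edge involution `Prod.swap`, oriented vertex rotation `hullSucc X`):

* `hullFace X p = hullSucc X p.swap` — the face successor `φ_H = σ_H ∘ α` (arrive at the head,
  turn counter-clockwise), a permutation of the darts (`hullFace_bijOn`);
* **`hullFace_hullFace_hullFace`** — `φ_H³ = id` on darts, with `φ_H p ≠ p`, `φ_H² p ≠ p`: every
  face has exactly three darts;
* `faceTri X p = {p.1, p.2, (φ_H p).2}` — the face through `p` IS a fan triangle
  (`faceTri_mem_fanTriSets`), constant along `φ_H` (`faceTri_hullFace`), every fan triangle is a
  face (`exists_faceTri_eq`), and the fibre of `faceTri` over a triangle is exactly one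
  `φ_H`-orbit (`eq_or_eq_or_eq_of_faceTri_eq`, `card_filter_faceTri_eq` = 3); the face through
  `(y, a)` is the NEGATIVELY oriented triangle on the dart (`orient3_faceTri_neg`: faces are
  traversed clockwise seen from outside, i.e. with the face on the right, as typer-bulk-2's
  `ofaceSucc`);
* counts: **`card_hullDarts : #hullDarts X = 3 · #fanTriSets X`** and
  **`card_fanTriSets_add_four : #fanTriSets X + 4 = 2 · #X`** (Legendre / Euler for the
  triangulated sphere: `F = 2N − 4`, `#darts = 2E = 6N − 12`); every point of `X` is the tail
  of a dart (`exists_mk_mem_hullDarts`).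

The vertex cycles (`σ_H` is ONE cycle at each point of `X`, so `V = N`) and connectedness are
part 3 (`Bulk/HullRotSysCycles.lean`).
-/

noncomputable section

namespace Summit.Ventures.Crystal3D

namespace HullRotSys

open Literature.Geometry.DiscreteGeometry Finset

variable {X : Finset (EuclideanSpace ℝ (Fin 3))}

/-! ## The face permutation -/

/-- **The face successor `φ_H = σ_H ∘ α`**: `φ_H (y, a) = σ_H (a, y) = (a, succV X a y)` — arrive
at `a` along `y → a` and leave along the next arc at `a` counter-clockwise after `a → y`. -/
def hullFace (X : Finset (EuclideanSpace ℝ (Fin 3))) (p : EuclideanSpace ℝ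
    (Fin 3) × EuclideanSpace ℝ (Fin 3)) : EuclideanSpace ℝ (Fin 3) × EuclideanSpace ℝ (Fin 3)
    := hullSucc X p.swap

/-- `φ_H` on a pair. -/
theorem hullFace_mk (y a : EuclideanSpace ℝ (Fin 3)) : hullFace X (y, a) = (a, succV X a y) := rfl

/-- The tail of `φ_H p` is the head of `p`. -/
@[simp] theorem hullFace_fst (p : EuclideanSpace ℝ (Fin 3) × EuclideanSpace ℝ (Fin 3)) :
    (hullFace X p).1 = p.2 := rfl

/-- `φ_H` maps darts to darts. -/
theorem hullFace_mem_hullDarts (hX1 : ∀ y ∈ X, ‖y‖ = 1)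
    (h0 : (0 : EuclideanSpace ℝ (Fin 3)) ∈ interior (convexHull ℝ (X : Set _))) {p
        : EuclideanSpace ℝ (Fin 3) × EuclideanSpace ℝ (Fin 3)} (hp : p ∈ hullDarts X) :
    hullFace X p ∈ hullDarts X :=
  hullSucc_mem_hullDarts hX1 h0 (swap_mem_hullDarts hp)

/-- `φ_H` is injective on the darts. -/
theorem hullFace_injOn (hX1 : ∀ y ∈ X, ‖y‖ = 1)
    (h0 : (0 : EuclideanSpace ℝ (Fin 3)) ∈ interior (convexHull ℝ (X : Set _))) :
    Set.InjOn (hullFace X) (hullDarts X : Set _) := by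
  intro p hp q hq h
  have h' := hullSucc_injOn hX1 h0 (Finset.mem_coe.2 (swap_mem_hullDarts (Finset.mem_coe.1 hp)))
    (Finset.mem_coe.2 (swap_mem_hullDarts (Finset.mem_coe.1 hq))) h
  exact Prod.swap_injective h'

/-- **`φ_H` is a permutation of the darts.** -/
theorem hullFace_bijOn (hX1 : ∀ y ∈ X, ‖y‖ = 1)
    (h0 : (0 : EuclideanSpace ℝ (Fin 3)) ∈ interior (convexHull ℝ (X : Set _))) :
    Set.BijOn (hullFace X) (hullDarts X : Set _) (hullDarts X : Set _) := by
  have hmaps : Set.MapsTo (hullFace X) (hullDarts X : Set _) (hullDarts X) :=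
    fun p hp => Finset.mem_coe.2 (hullFace_mem_hullDarts hX1 h0 (Finset.mem_coe.1 hp))
  exact ⟨hmaps, hullFace_injOn hX1 h0,
    Finset.surjOn_of_injOn_of_card_le _ hmaps (hullFace_injOn hX1 h0) le_rfl⟩

/-- The positively oriented triple behind `φ_H`: `(a, y, (φ_H (y, a)).2)`. -/
theorem isPosThird_hullFace (hX1 : ∀ y ∈ X, ‖y‖ = 1)
    (h0 : (0 : EuclideanSpace ℝ (Fin 3)) ∈ interior (convexHull ℝ (X : Set _))) {y a
        : EuclideanSpace ℝ (Fin 3)} (hp : (y, a) ∈ hullDarts X) :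
    IsPosThird X a y (hullFace X (y, a)).2 :=
  isPosThird_succV hX1 h0 (swap_mem_hullDarts hp)

/-- **`φ_H²`**: `φ_H (φ_H (y, a)) = (x, y)` where `(a, x) = φ_H (y, a)`. -/
theorem hullFace_hullFace (hX1 : ∀ y ∈ X, ‖y‖ = 1)
    (h0 : (0 : EuclideanSpace ℝ (Fin 3)) ∈ interior (convexHull ℝ (X : Set _))) {y a
        : EuclideanSpace ℝ (Fin 3)} (hp : (y, a) ∈ hullDarts X) :
    hullFace X (hullFace X (y, a)) = (succV X a y, y) := by
  have h := isPosThird_succV hX1 h0 (swap_mem_hullDarts hp)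
  rw [hullFace_mk, hullFace_mk, Prod.mk.injEq]
  refine ⟨rfl, ?_⟩
  have hxa : (succV X a y, a) ∈ hullDarts X :=
    mk_mem_hullDarts h.1 (by simp) (by simp) (Ne.symm h.ne₁₃)
  exact (succV_eq_iff hX1 h0 hxa).2 h.cyclic.cyclic

/-- **`φ_H³ = id` on darts**: every face of the hull rotation system is a triangle. -/
theorem hullFace_hullFace_hullFace (hX1 : ∀ y ∈ X, ‖y‖ = 1)
    (h0 : (0 : EuclideanSpace ℝ (Fin 3)) ∈ interior (convexHull ℝ (X : Set _))) {p
        : EuclideanSpace ℝ (Fin 3) × EuclideanSpace ℝ (Fin 3)} (hp : p ∈ hullDarts X) :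
    hullFace X (hullFace X (hullFace X p)) = p := by
  obtain ⟨y, a⟩ := p
  have h := isPosThird_succV hX1 h0 (swap_mem_hullDarts hp)
  rw [hullFace_hullFace hX1 h0 hp, hullFace_mk, Prod.mk.injEq]
  refine ⟨rfl, ?_⟩
  have hyx : (y, succV X a y) ∈ hullDarts X := mk_mem_hullDarts h.1 (by simp) (by simp) h.ne₂₃
  exact (succV_eq_iff hX1 h0 hyx).2 h.cyclic

/-- `φ_H` has no fixed dart. -/
theorem hullFace_ne_self {p : EuclideanSpace ℝ (Fin 3) × EuclideanSpace ℝ (Fin 3)} (hp : p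
    ∈ hullDarts X) : hullFace X p ≠ p := by
  intro h
  have h1 : p.2 = p.1 := by simpa using congrArg Prod.fst h
  exact fst_ne_snd_of_mem_hullDarts hp h1.symm

/-- `φ_H²` has no fixed dart. -/
theorem hullFace_hullFace_ne_self (hX1 : ∀ y ∈ X, ‖y‖ = 1)
    (h0 : (0 : EuclideanSpace ℝ (Fin 3)) ∈ interior (convexHull ℝ (X : Set _))) {p
        : EuclideanSpace ℝ (Fin 3) × EuclideanSpace ℝ (Fin 3)} (hp : p ∈ hullDarts X) :
    hullFace X (hullFace X p) ≠ p := by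
  obtain ⟨y, a⟩ := p
  rw [hullFace_hullFace hX1 h0 hp]
  have h := isPosThird_succV hX1 h0 (swap_mem_hullDarts hp)
  intro heq
  exact h.ne₂₃ (congrArg Prod.fst heq).symm

/-! ## Faces are the fan triangles -/

/-- **The face through a dart**: the vertex set `{y, a, x}` of the `φ_H`-orbit of `(y, a)`. -/
def faceTri (X : Finset (EuclideanSpace ℝ (Fin 3))) (p : EuclideanSpace ℝ
    (Fin 3) × EuclideanSpace ℝ (Fin 3)) : Finset (EuclideanSpace ℝ (Fin 3)) := {p.1, p.2,
    (hullFace X p).2}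

/-- `faceTri` on a pair. -/
theorem faceTri_mk (y a : EuclideanSpace ℝ (Fin 3)) : faceTri X (y, a) = {y, a, succV X a y} := rfl

/-- The face through a dart is a fan triangle. -/
theorem faceTri_mem_fanTriSets (hX1 : ∀ y ∈ X, ‖y‖ = 1)
    (h0 : (0 : EuclideanSpace ℝ (Fin 3)) ∈ interior (convexHull ℝ (X : Set _))) {p
        : EuclideanSpace ℝ (Fin 3) × EuclideanSpace ℝ (Fin 3)} (hp : p ∈ hullDarts X) :
    faceTri X p ∈ fanTriSets X := by
  obtain ⟨y, a⟩ := p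
  have h := isPosThird_succV hX1 h0 (swap_mem_hullDarts hp)
  have e : ({y, a, succV X a y} : Finset (EuclideanSpace ℝ (Fin 3))) = {a, y, succV X a y} := by
    ext z; simp only [mem_insert, mem_singleton]; tauto
  rw [faceTri_mk, e]
  exact h.1

/-- **Faces are traversed clockwise (face on the right)**: the face through `(y, a)` is the
NEGATIVELY oriented fan triangle on the dart, `orient3 y a x < 0`. -/
theorem orient3_faceTri_neg (hX1 : ∀ y ∈ X, ‖y‖ = 1)
    (h0 : (0 : EuclideanSpace ℝ (Fin 3)) ∈ interior (convexHull ℝ (X : Set _))) {y a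
        : EuclideanSpace ℝ (Fin 3)} (hp : (y, a) ∈ hullDarts X) :
    orient3 y a (hullFace X (y, a)).2 < 0 := by
  have h := isPosThird_succV hX1 h0 (swap_mem_hullDarts hp)
  rw [hullFace_mk, orient3_swap_left, neg_lt_zero]
  exact h.2

/-- `faceTri` is constant along `φ_H`. -/
theorem faceTri_hullFace (hX1 : ∀ y ∈ X, ‖y‖ = 1)
    (h0 : (0 : EuclideanSpace ℝ (Fin 3)) ∈ interior (convexHull ℝ (X : Set _))) {p
        : EuclideanSpace ℝ (Fin 3) × EuclideanSpace ℝ (Fin 3)} (hp : p ∈ hullDarts X) :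
    faceTri X (hullFace X p) = faceTri X p := by
  obtain ⟨y, a⟩ := p
  unfold faceTri
  rw [hullFace_hullFace hX1 h0 hp, hullFace_mk]
  ext z; simp only [mem_insert, mem_singleton]; tauto

/-- **Every fan triangle is a face**: `t = faceTri X p` for a dart `p` of `t`. -/
theorem exists_faceTri_eq (hX1 : ∀ y ∈ X, ‖y‖ = 1)
    (h0 : (0 : EuclideanSpace ℝ (Fin 3)) ∈ interior (convexHull ℝ (X : Set _))) {t : Finset
        (EuclideanSpace ℝ (Fin 3))} (ht : t ∈ fanTriSets X) :
    ∃ p ∈ hullDarts X, faceTri X p = t := by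
  obtain ⟨u, v, w, huv, huw, hvw, rfl⟩ := card_eq_three.1 (card_eq_three_of_mem_fanTriSets hX1 ht)
  have hO := orient3_ne_zero_of_mem_fanTriSets hX1 ht huv huw hvw
  rcases lt_or_gt_of_ne hO with hneg | hpos
  · -- `(u, v)`: the third vertex `w` is positively oriented for `(v, u)`
    have hd : (u, v) ∈ hullDarts X := mk_mem_hullDarts ht (by simp) (by simp) huv
    refine ⟨(u, v), hd, ?_⟩
    have hvu : IsPosThird X v u w := by
      refine ⟨?_, by rw [orient3_swap_left]; linarith⟩
      have e : ({v, u, w} : Finset (EuclideanSpace ℝ (Fin 3))) = {u, v, w} := by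
        ext z; simp only [mem_insert, mem_singleton]; tauto
      rw [e]; exact ht
    rw [faceTri_mk, (succV_eq_iff hX1 h0 (swap_mem_hullDarts hd)).2 hvu]
  · -- `(u, w)`: the third vertex `v` is positively oriented for `(w, u)`
    have hd : (u, w) ∈ hullDarts X := mk_mem_hullDarts ht (by simp) (by simp) huw
    refine ⟨(u, w), hd, ?_⟩
    have hwu : IsPosThird X w u v := by
      refine ⟨?_, by rw [orient3_cyclic]; exact hpos⟩
      have e : ({w, u, v} : Finset (EuclideanSpace ℝ (Fin 3))) = {u, v, w} := by
        ext z; simp only [mem_insert, mem_singleton]; tauto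
      rw [e]; exact ht
    rw [faceTri_mk, (succV_eq_iff hX1 h0 (swap_mem_hullDarts hd)).2 hwu]
    ext z; simp only [mem_insert, mem_singleton]; tauto

/-- **The fibre of `faceTri` is one `φ_H`-orbit**: two darts with the same face are `φ_H`-related
(of the six ordered pairs of a triangle, exactly the three oriented clockwise have it as face). -/
theorem eq_or_eq_or_eq_of_faceTri_eq (hX1 : ∀ y ∈ X, ‖y‖ = 1)
    (h0 : (0 : EuclideanSpace ℝ (Fin 3)) ∈ interior (convexHull ℝ (X : Set _))) {p q
        : EuclideanSpace ℝ (Fin 3) × EuclideanSpace ℝ (Fin 3)} (hp : p ∈ hullDarts X)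
    (hq : q ∈ hullDarts X) (h : faceTri X q = faceTri X p) :
    q = p ∨ q = hullFace X p ∨ q = hullFace X (hullFace X p) := by
  obtain ⟨y, a⟩ := p
  obtain ⟨u, v⟩ := q
  have H : IsPosThird X a y (succV X a y) := isPosThird_succV hX1 h0 (swap_mem_hullDarts hp)
  have Hq : IsPosThird X v u (succV X v u) := isPosThird_succV hX1 h0 (swap_mem_hullDarts hq)
  rw [hullFace_hullFace hX1 h0 hp, hullFace_mk]
  rw [faceTri_mk, faceTri_mk] at h
  generalize hx : succV X a y = x at H h ⊢
  generalize hw : succV X v u = w at Hq h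
  have hu : u ∈ ({y, a, x} : Finset (EuclideanSpace ℝ (Fin 3))) := by rw [← h]; simp
  have hv : v ∈ ({y, a, x} : Finset (EuclideanSpace ℝ (Fin 3))) := by rw [← h]; simp
  have hw' : w ∈ ({y, a, x} : Finset (EuclideanSpace ℝ (Fin 3))) := by rw [← h]; simp
  have huv : u ≠ v := Ne.symm Hq.ne₁₂
  have hvw : v ≠ w := Hq.ne₁₃
  have huw : u ≠ w := Hq.ne₂₃
  have hO : 0 < orient3 a y x := H.2
  have hOq : 0 < orient3 v u w := Hq.2
  simp only [mem_insert, mem_singleton] at hu hv hw'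
  -- 27 label assignments: the degenerate ones contradict distinctness, the odd permutations of
  -- `(y, a, x)` contradict the orientations, the even ones are the three darts of the orbit
  rcases hu with hU | hU | hU <;> rcases hv with hV | hV | hV <;> rcases hw' with hW | hW | hW <;>
    rw [hU, hV, hW] at hOq <;> rw [hU, hV] <;>
    first
    | exact absurd (hU.trans hV.symm) huv
    | exact absurd (hV.trans hW.symm) hvw
    | exact absurd (hU.trans hW.symm) huw
    | exact Or.inl rfl
    | exact Or.inr (Or.inl rfl)
    | exact Or.inr (Or.inr rfl)
    | (exfalso; linarith [orient3_cyclic y a x, orient3_cyclic a x y, orient3_swap_left a y x])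

/-- The fibre of `faceTri` over a fan triangle has exactly three darts. -/
theorem card_filter_faceTri_eq (hX1 : ∀ y ∈ X, ‖y‖ = 1)
    (h0 : (0 : EuclideanSpace ℝ (Fin 3)) ∈ interior (convexHull ℝ (X : Set _))) {t : Finset
        (EuclideanSpace ℝ (Fin 3))} (ht : t ∈ fanTriSets X) :
    ((hullDarts X).filter fun q => faceTri X q = t).card = 3 := by
  obtain ⟨p, hp, rfl⟩ := exists_faceTri_eq hX1 h0 ht
  have h1 := hullFace_mem_hullDarts hX1 h0 hp
  have h2 := hullFace_mem_hullDarts hX1 h0 h1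
  have heq : ((hullDarts X).filter fun q => faceTri X q = faceTri X p) =
      {p, hullFace X p, hullFace X (hullFace X p)} := by
    ext q
    simp only [mem_filter, mem_insert, mem_singleton]
    constructor
    · rintro ⟨hq, h⟩
      exact eq_or_eq_or_eq_of_faceTri_eq hX1 h0 hp hq h
    · rintro (rfl | rfl | rfl)
      · exact ⟨hp, rfl⟩
      · exact ⟨h1, faceTri_hullFace hX1 h0 hp⟩
      · exact ⟨h2, by rw [faceTri_hullFace hX1 h0 h1, faceTri_hullFace hX1 h0 hp]⟩
  rw [heq]
  have n01 : p ≠ hullFace X p := (hullFace_ne_self hp).symm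
  have n02 : p ≠ hullFace X (hullFace X p) := (hullFace_hullFace_ne_self hX1 h0 hp).symm
  have n12 : hullFace X p ≠ hullFace X (hullFace X p) := (hullFace_ne_self h1).symm
  rw [card_insert_of_notMem, card_pair n12]
  simp only [mem_insert, mem_singleton, not_or]
  exact ⟨n01, n02⟩

/-! ## Counts -/

/-- **`#darts = 3 · #triangles`** (each face has three darts; equivalently `#darts = 2E` with
`3F = 2E`). -/
theorem card_hullDarts (hX1 : ∀ y ∈ X, ‖y‖ = 1)
    (h0 : (0 : EuclideanSpace ℝ (Fin 3)) ∈ interior (convexHull ℝ (X : Set _))) :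
    (hullDarts X).card = 3 * (fanTriSets X).card := by
  rw [card_eq_sum_card_fiberwise (fun p hp => faceTri_mem_fanTriSets hX1 h0 hp),
    sum_congr rfl fun t ht => card_filter_faceTri_eq hX1 h0 ht, sum_const, smul_eq_mul, mul_comm]

/-- **Legendre's count `F = 2N − 4`** for the fan triangulation: `#fanTriSets X + 4 = 2 · #X`
(from the tree's `sum_card_tightSet_eq`: `Σ_facets m = 2N + 2·#facets − 4`, and
`#fanTriangles = Σ_facets (m − 2)`). -/
theorem card_fanTriSets_add_four (hX1 : ∀ y ∈ X, ‖y‖ = 1)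
    (h0 : (0 : EuclideanSpace ℝ (Fin 3)) ∈ interior (convexHull ℝ (X : Set _))) :
    (fanTriSets X).card + 4 = 2 * X.card := by
  have hT : (fanTriSets X).card = ∑ c ∈ facetNormals X, ((tightSet X c).card - 2) := by
    unfold fanTriSets
    rw [card_image_of_injOn (fanVerts_injOn hX1), card_fanTriangles_eq_sum]
  have h := sum_card_tightSet_eq hX1 h0
  have h3 : ∀ c ∈ facetNormals X, 3 ≤ (tightSet X c).card := fun c hc => three_le_card_tightSet hc
  have hcast : ((∑ c ∈ facetNormals X, ((tightSet X c).card - 2) : ℕ) : ℝ) =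
      ∑ c ∈ facetNormals X, ((tightSet X c).card : ℝ) - 2 * (facetNormals X).card := by
    push_cast
    rw [Finset.sum_congr rfl fun c hc => by rw [Nat.cast_sub (by have := h3 c hc; omega)],
      Finset.sum_sub_distrib]
    simp [Finset.sum_const, nsmul_eq_mul, mul_comm]
  have hR : ((fanTriSets X).card : ℝ) + 4 = 2 * X.card := by
    rw [hT, hcast, h]; ring
  exact_mod_cast hR

/-- `#darts = 6N − 12` (`= 2E`, `E = 3N − 6`). -/
theorem card_hullDarts_add_twelve (hX1 : ∀ y ∈ X, ‖y‖ = 1)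
    (h0 : (0 : EuclideanSpace ℝ (Fin 3)) ∈ interior (convexHull ℝ (X : Set _))) :
    (hullDarts X).card + 12 = 6 * X.card := by
  have h1 := card_hullDarts hX1 h0
  have h2 := card_fanTriSets_add_four hX1 h0
  omega

/-- **Every point of `X` is the tail of a dart** (its node equation `Σ angles = 2π` is not
empty): the vertex set of the hull rotation system is all of `X`. -/
theorem exists_mk_mem_hullDarts (hX1 : ∀ y ∈ X, ‖y‖ = 1)
    (h0 : (0 : EuclideanSpace ℝ (Fin 3)) ∈ interior (convexHull ℝ (X : Set _))) {y
        : EuclideanSpace ℝ (Fin 3)} (hy : y ∈ X) :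
    ∃ a : EuclideanSpace ℝ (Fin 3), (y, a) ∈ hullDarts X := by
  obtain ⟨t, ht, hne⟩ : ∃ t ∈ fanTriSets X, triAngleAt X t y ≠ 0 := by
    by_contra hno
    have hzero : ∀ t ∈ fanTriSets X, triAngleAt X t y = 0 := by
      intro t ht
      by_contra h
      exact hno ⟨t, ht, h⟩
    have h := sum_triAngleAt hX1 h0 hy
    rw [sum_eq_zero hzero] at h
    linarith [Real.pi_pos]
  have hyt : y ∈ t := by
    by_contra h
    exact hne (triAngleAt_eq_zero_of_not_mem h)
  have h3 := card_eq_three_of_mem_fanTriSets hX1 ht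
  obtain ⟨a, ha, hay⟩ := exists_mem_ne (by omega : 1 < t.card) y
  exact ⟨a, mk_mem_hullDarts ht hyt ha (Ne.symm hay)⟩

/-- The tails of the darts are exactly the points of `X`. -/
theorem image_fst_hullDarts (hX1 : ∀ y ∈ X, ‖y‖ = 1)
    (h0 : (0 : EuclideanSpace ℝ (Fin 3)) ∈ interior (convexHull ℝ (X : Set _))) :
    (hullDarts X).image Prod.fst = X := by
  ext y
  rw [mem_image]
  constructor
  · rintro ⟨p, hp, rfl⟩
    exact fst_mem_of_mem_hullDarts hX1 hp
  · intro hy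
    obtain ⟨a, ha⟩ := exists_mk_mem_hullDarts hX1 h0 hy
    exact ⟨(y, a), ha, rfl⟩

end HullRotSys

end Summit.Ventures.Crystal3D
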